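import Literature.NumberTheory.Automorphic.ArchLocalTorusOrbitalContinuity   -- ★ p839258 (V2)-glob FILE A (F0P3a-p06 (g9)): `coe_inv_apply_of_mem_unitaryGroupOfForm_diagonal`, `norm_coe_inv_apply_…`, §2 skeleton
import Literature.NumberTheory.Automorphic.ArchLocalRegularTorusClasses      -- ★ (F0P3a-p02): `mem_archLocal_diagonal_iff_mem_unitaryGroupOfForm`, `re_embedding_ne_zero` (real weights `e_i = re σ_w(α_i)`)
import HarnessLib

/-!
# Joint properness of conjugation over the circle torus of `G_w = U(σ_w diag α)(ℂ)` ACROSS COMPACT WALLS: block-separated parameter sets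
# (ROAD-Sd clause (C-cw) of the letter census of record, FILE 1 of 2; Rogawski 1990 §8.2 pp. 122–123; Deitmar–Echterhoff Lemma 9.3.3)

Topic `NumberTheory/Automorphic`; namespace `Literature.NumberTheory.Automorphic.UnitaryGroup`.  THEOREMS ONLY (no `def`, no instance, no notation, no axiom, no named
fact, no `sorry`).  Cell `pub/hodgecm-mathlib`, ENGINE T1 (crux H413 = `stmt-HodgeConjecture-24833`); floor-1 preparation, count-neutral, under books rows #111 (S-d) ∕ #88
(ST-∞): ROAD-Sd map of record `CENSUS-ROAD-Sd-letters` (F0P3a-p06 (g10), 3ec10e9b) clause **(C-cw) «compact-wall continuity»** (LEAD DESK WORD T8-15 (C), F0P3a-plan (g9),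
2026-09-01); author F0P3a-p06 (g10); per place on `archLocal L N (diagonal α) w` (desk ruling T6-84 (V7)).  STRICT GENERALISATION of ★ FILE A `ArchLocalTorusOrbitalContinuity`
(p839258): there the parameter set was the REGULAR set (`z` injective); here coincidences `z_i = z_j` are allowed INSIDE BLOCKS of a labelling `b : Fin N → ι` on which the
real weights `e_i = re σ_w(α_i)` have CONSTANT SIGN (each block spans a DEFINITE subspace, so the centraliser of a wall point is COMPACT in the block directions) — `b`
injective is FILE A, `b` constant is the definite place (★ p838154 §2), and `N = 3`, `b 0 = b 2 ≠ b 1`, `e_0 e_2 > 0` is THE COMPACT WALL of `U(2,1)` (print's `γ₂ → γ₀′`,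
centraliser `U(2) × U(1)`, §8.2 p. 122).  Continuity consequences: FILE 2 `ArchLocalTorusOrbitalCompactWallContinuity`.
MECHANISM (§1, denominator-free — no Vandermonde inverse): for `g ∈ U(diag e)(ℂ)`, `x = g·diag z·g⁻¹` and a block `I`, `Q_I(x, z) := ∏_{j ∉ I} (x − z_j·1)` (a `List.prod`,
jointly continuous in `(x, z)`) equals `g·diag λ·g⁻¹`, `λ_m = ∏_{j ∉ I}(z_m − z_j)` (zero off `I`), and **`(Q_I · D⁻¹ · Q_Iᴴ)_{kk} = Σ_m |λ_m|² e_m⁻¹ |g_{km}|²`** (`g⁻¹ = D⁻¹ gᴴ D`,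
`gᴴ D g = D`); on a constant-sign block the terms cannot cancel, whence **`|g_{ki}|² ≤ |e_i| · |λ_i|⁻² · |(Q_I D⁻¹ Q_Iᴴ)_{kk}|`**, continuous in `(x, z)` where blocks are separated.
WHAT IS PROVED. §1 `list_prod_map_units_conj`, `diagonal_sub_smul_one`, `list_prod_map_diagonal_sub_smul_one`, `list_prod_map_conj_diagonal_sub_smul_one` (`Q_I = g·diag λ·g⁻¹`),
`coe_inv_eq_of_mem_unitaryGroupOfForm_diagonal` (`g⁻¹ = D⁻¹ gᴴ D`), **`conj_diagonal_mul_formInv_mul_conjTranspose`** (`Q D⁻¹ Qᴴ = g·diag(λ e⁻¹ λ̄)·gᴴ`),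
`mul_diagonal_mul_conjTranspose_apply_self`, **`norm_apply_sq_le_of_block`** (the bound).  §2
**`isCompact_setOf_exists_conj_circleDiagonal_mem_of_blocks`** — for `K` compact inside the block-separated set `{z | ∀ i j, b i ≠ b j → z i ≠ z j}` and `C ⊆ G_w` compact,
`{g | ∃ z ∈ K, g·diag z·g⁻¹ ∈ C}` is COMPACT (FILE A §2 skeleton with the §1 bound); `hasCompactSupport_comp_conj_circleDiagonal_of_blocks`.
NOT HERE: continuity and the `N = 3` corollaries (FILE 2); (J-cw); noncompact walls ((C-bdry)∕(J-nc): LETTERS — properness FAILS there).  HONEST LABEL: HC_CM is proved only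
modulo the printed citations until rung 0 closes; this file is linear algebra + point-set topology on a real group and pays nothing by itself.

## References
* [Rogawski1990] J. D. Rogawski, *Automorphic Representations of Unitary Groups in Three Variables*, Ann. of Math. Stud. 123 (1990), §8.2 pp. 122–123 (as `ψ → 0`,
  `γ₂ → γ₀′` with COMPACT centraliser `H′ = U(2) × U(1)`; `Φ_{H′}(γ₂, F′)` smooth through the wall), §3.1 p. 19, §1.9 p. 8.
* [DeitmarEchterhoff2014] A. Deitmar, S. Echterhoff, *Principles of Harmonic Analysis*, 2nd ed. (2014), Lemma 9.3.3 (properness of conjugation), Cor. 1.5.4.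
* [HornJohnson2013] R. A. Horn, C. R. Johnson, *Matrix Analysis*, 2nd ed. (2013), Thm. 1.3.9 ∕ §4.5 (spectral projectors as polynomials in the matrix; Sylvester).
-/

set_option autoImplicit false

noncomputable section

open MeasureTheory Measure NumberField NumberField.InfinitePlace Filter Topology Matrix
open Literature.MeasureTheory.Group
open scoped MatrixGroups ComplexConjugate

namespace Literature.NumberTheory.Automorphic.UnitaryGroup

/-! ## §1 The block polynomial `Q_I(x, z) = ∏_{j ∉ I}(x − z_j)` and the entry bound on a constant-sign block -/

section Algebra

variable {N : ℕ}

/-- Conjugation is multiplicative along a list: `∏_j (g a_j g⁻¹) = g (∏_j a_j) g⁻¹` (similarity is a ring automorphism). [cite: HornJohnson2013, §1.3 (Obs. 1.3.1)] -/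
theorem list_prod_map_units_conj (g : GL (Fin N) ℂ) {κ : Type*} (l : List κ) (a : κ → Matrix (Fin N) (Fin N) ℂ) :
    (l.map fun j => (g : Matrix (Fin N) (Fin N) ℂ) * a j * ((g⁻¹ : GL (Fin N) ℂ) : Matrix (Fin N) (Fin N) ℂ)).prod =
      (g : Matrix (Fin N) (Fin N) ℂ) * (l.map a).prod * ((g⁻¹ : GL (Fin N) ℂ) : Matrix (Fin N) (Fin N) ℂ) := by
  induction l with
  | nil => simp only [List.map_nil, List.prod_nil, Matrix.mul_one, Units.mul_inv]
  | cons j l ih =>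
    simp only [List.map_cons, List.prod_cons]
    rw [ih]
    simp only [Matrix.mul_assoc, Units.inv_mul_cancel_left]

/-- `diag z − c·1 = diag(z − c)`. [cite: HornJohnson2013, §0.9.1] -/
theorem diagonal_sub_smul_one (z : Fin N → ℂ) (c : ℂ) :
    diagonal z - c • (1 : Matrix (Fin N) (Fin N) ℂ) = diagonal fun m => z m - c := by
  rw [smul_one_eq_diagonal, diagonal_sub]

/-- `∏_j (diag z − c_j·1) = diag(m ↦ ∏_j (z_m − c_j))` (diagonal matrices form a commutative subalgebra). [cite: HornJohnson2013, §0.9.1] -/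
theorem list_prod_map_diagonal_sub_smul_one {κ : Type*} (l : List κ) (z : Fin N → ℂ) (c : κ → ℂ) :
    (l.map fun j => diagonal z - c j • (1 : Matrix (Fin N) (Fin N) ℂ)).prod = diagonal fun m => (l.map fun j => z m - c j).prod := by
  induction l with
  | nil => simp only [List.map_nil, List.prod_nil, diagonal_one]
  | cons j l ih =>
    simp only [List.map_cons, List.prod_cons]
    rw [ih, diagonal_sub_smul_one, diagonal_mul_diagonal]

/-- **`Q_I(g·diag z·g⁻¹, z) = g · diag(λ) · g⁻¹`**, `λ_m = ∏_j (z_m − c_j)`: a product of the commuting factors `x − c_j·1` of a conjugated diagonal matrix is the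
conjugate of the diagonal matrix of products. [cite: HornJohnson2013, Thm. 1.3.9] -/
theorem list_prod_map_conj_diagonal_sub_smul_one (g : GL (Fin N) ℂ) {κ : Type*} (l : List κ) (z : Fin N → ℂ) (c : κ → ℂ) :
    (l.map fun j => (g : Matrix (Fin N) (Fin N) ℂ) * diagonal z * ((g⁻¹ : GL (Fin N) ℂ) : Matrix (Fin N) (Fin N) ℂ) -
        c j • (1 : Matrix (Fin N) (Fin N) ℂ)).prod =
      (g : Matrix (Fin N) (Fin N) ℂ) * diagonal (fun m => (l.map fun j => z m - c j).prod) * ((g⁻¹ : GL (Fin N) ℂ) : Matrix (Fin N) (Fin N) ℂ) := by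
  have h : (fun j => (g : Matrix (Fin N) (Fin N) ℂ) * diagonal z * ((g⁻¹ : GL (Fin N) ℂ) : Matrix (Fin N) (Fin N) ℂ) -
      c j • (1 : Matrix (Fin N) (Fin N) ℂ)) =
      fun j => (g : Matrix (Fin N) (Fin N) ℂ) * (diagonal z - c j • (1 : Matrix (Fin N) (Fin N) ℂ)) * ((g⁻¹ : GL (Fin N) ℂ) : Matrix (Fin N) (Fin N) ℂ) := by
    funext j
    rw [Matrix.mul_sub, Matrix.sub_mul, Matrix.mul_smul, Matrix.smul_mul, Matrix.mul_one, Units.mul_inv]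
  rw [h, list_prod_map_units_conj, list_prod_map_diagonal_sub_smul_one]

/-- **`g⁻¹ = D⁻¹ · gᴴ · D`** for `g ∈ U(diag e)(ℂ)`, `e` real non-zero (★ FILE A `coe_inv_apply_of_mem_unitaryGroupOfForm_diagonal`, entrywise). [cite: Rogawski1990, §1.9 p. 8] -/
theorem coe_inv_eq_of_mem_unitaryGroupOfForm_diagonal {e : Fin N → ℝ} (he : ∀ i, e i ≠ 0) {g : GL (Fin N) ℂ}
    (hg : g ∈ unitaryGroupOfForm (starRingEnd ℂ) (diagonal fun i => (e i : ℂ))) :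
    ((g⁻¹ : GL (Fin N) ℂ) : Matrix (Fin N) (Fin N) ℂ) =
      diagonal (fun i => (e i : ℂ)⁻¹) * (g : Matrix (Fin N) (Fin N) ℂ)ᴴ * diagonal (fun i => (e i : ℂ)) := by
  have he' : ∀ i, (e i : ℂ) ≠ 0 := fun i => Complex.ofReal_ne_zero.mpr (he i)
  ext i k
  rw [coe_inv_apply_of_mem_unitaryGroupOfForm_diagonal he' hg, mul_diagonal, diagonal_mul, conjTranspose_apply, RCLike.star_def, mul_assoc]

/-- **`Q · D⁻¹ · Qᴴ = g · diag(λ_m e_m⁻¹ λ̄_m) · gᴴ`** for `Q = g·diag λ·g⁻¹`, `g ∈ U(diag e)(ℂ)` (`g⁻¹ = D⁻¹gᴴD`, `gᴴ D g = D`). [cite: HornJohnson2013, §4.5]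
[cite: Rogawski1990, §1.9 p. 8] -/
theorem conj_diagonal_mul_formInv_mul_conjTranspose {e : Fin N → ℝ} (he : ∀ i, e i ≠ 0) {g : GL (Fin N) ℂ}
    (hg : g ∈ unitaryGroupOfForm (starRingEnd ℂ) (diagonal fun i => (e i : ℂ))) (d : Fin N → ℂ) :
    (g : Matrix (Fin N) (Fin N) ℂ) * diagonal d * ((g⁻¹ : GL (Fin N) ℂ) : Matrix (Fin N) (Fin N) ℂ) * diagonal (fun i => (e i : ℂ)⁻¹) *
        ((g : Matrix (Fin N) (Fin N) ℂ) * diagonal d * ((g⁻¹ : GL (Fin N) ℂ) : Matrix (Fin N) (Fin N) ℂ))ᴴ =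
      (g : Matrix (Fin N) (Fin N) ℂ) * diagonal (fun m => d m * (e m : ℂ)⁻¹ * star (d m)) * (g : Matrix (Fin N) (Fin N) ℂ)ᴴ := by
  have he' : ∀ i, (e i : ℂ) ≠ 0 := fun i => Complex.ofReal_ne_zero.mpr (he i)
  -- the form identity `gᴴ D g = D` (membership, definitionally)
  have h0 : ((g : Matrix (Fin N) (Fin N) ℂ).map (starRingEnd ℂ))ᵀ * diagonal (fun i => (e i : ℂ)) * (g : Matrix (Fin N) (Fin N) ℂ) =
      diagonal fun i => (e i : ℂ) := hg
  have hform : (g : Matrix (Fin N) (Fin N) ℂ)ᴴ * diagonal (fun i => (e i : ℂ)) * (g : Matrix (Fin N) (Fin N) ℂ) = diagonal fun i => (e i : ℂ) := h0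
  -- the real diagonal matrices are self-adjoint and mutually inverse
  have hD : (diagonal fun i => (e i : ℂ))ᴴ = diagonal fun i => (e i : ℂ) := by
    rw [diagonal_conjTranspose]; congr 1; funext i; exact Complex.conj_ofReal _
  have hD' : (diagonal fun i => (e i : ℂ)⁻¹)ᴴ = diagonal fun i => (e i : ℂ)⁻¹ := by
    rw [diagonal_conjTranspose]; congr 1; funext i
    rw [Pi.star_apply, RCLike.star_def, map_inv₀, Complex.conj_ofReal]
  have F1 : ∀ X : Matrix (Fin N) (Fin N) ℂ, diagonal (fun i => (e i : ℂ)) * (diagonal (fun i => (e i : ℂ)⁻¹) * X) = X := fun X => by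
    rw [← Matrix.mul_assoc, diagonal_mul_diagonal, show (fun i => (e i : ℂ) * (e i : ℂ)⁻¹) = fun _ => 1 from funext fun i => mul_inv_cancel₀ (he' i),
      diagonal_one, Matrix.one_mul]
  have F1' : ∀ X : Matrix (Fin N) (Fin N) ℂ, diagonal (fun i => (e i : ℂ)⁻¹) * (diagonal (fun i => (e i : ℂ)) * X) = X := fun X => by
    rw [← Matrix.mul_assoc, diagonal_mul_diagonal, show (fun i => (e i : ℂ)⁻¹ * (e i : ℂ)) = fun _ => 1 from funext fun i => inv_mul_cancel₀ (he' i),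
      diagonal_one, Matrix.one_mul]
  have F2 : ∀ X : Matrix (Fin N) (Fin N) ℂ, (g : Matrix (Fin N) (Fin N) ℂ)ᴴ * (diagonal (fun i => (e i : ℂ)) * ((g : Matrix (Fin N) (Fin N) ℂ) * X)) =
      diagonal (fun i => (e i : ℂ)) * X := fun X => by
    rw [← Matrix.mul_assoc, ← Matrix.mul_assoc, hform]
  rw [coe_inv_eq_of_mem_unitaryGroupOfForm_diagonal he hg]
  simp only [conjTranspose_mul, conjTranspose_conjTranspose, hD, hD', diagonal_conjTranspose, Matrix.mul_assoc]
  rw [F1, F2, F1', ← Matrix.mul_assoc (diagonal d), ← Matrix.mul_assoc (diagonal d * _), diagonal_mul_diagonal, diagonal_mul_diagonal]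
  rfl

/-- The diagonal entry `(M · diag c · Mᴴ)_{kk} = Σ_m c_m · M_{km} · M̄_{km}` (a diagonal congruence evaluated on the rows of `M`). [cite: HornJohnson2013, §4.1 (4.1.P1)] -/
theorem mul_diagonal_mul_conjTranspose_apply_self (M : Matrix (Fin N) (Fin N) ℂ) (c : Fin N → ℂ) (k : Fin N) :
    (M * diagonal c * Mᴴ) k k = ∑ m, c m * (M k m * star (M k m)) := by
  rw [Matrix.mul_apply]
  refine Finset.sum_congr rfl fun m _ => ?_
  rw [mul_diagonal, conjTranspose_apply]
  ring

/-- **THE ENTRY BOUND ON A CONSTANT-SIGN BLOCK**: for `g ∈ U(diag e)(ℂ)` (`e` real), `Q = g·diag d·g⁻¹` with `d_i ≠ 0` and every `m` with `d_m ≠ 0` of the SAME SIGN as `i`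
(`0 < e_i e_m`): `‖g_{ki}‖² ≤ |e_i| · |d_i|⁻² · ‖(Q D⁻¹ Qᴴ)_{kk}‖` — no cancellation among the terms `|d_m|² e_m⁻¹ |g_{km}|²`. [cite: HornJohnson2013, §4.5]
[cite: DeitmarEchterhoff2014, Lemma 9.3.3] -/
theorem norm_apply_sq_le_of_block {e : Fin N → ℝ} (he : ∀ i, e i ≠ 0) {g : GL (Fin N) ℂ}
    (hg : g ∈ unitaryGroupOfForm (starRingEnd ℂ) (diagonal fun i => (e i : ℂ))) (d : Fin N → ℂ) (i k : Fin N)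
    (hdi : d i ≠ 0) (hsign : ∀ m, d m ≠ 0 → 0 < e i * e m) :
    ‖(g : Matrix (Fin N) (Fin N) ℂ) k i‖ ^ 2 ≤ |e i| * (Complex.normSq (d i))⁻¹ *
      ‖((g : Matrix (Fin N) (Fin N) ℂ) * diagonal d * ((g⁻¹ : GL (Fin N) ℂ) : Matrix (Fin N) (Fin N) ℂ) * diagonal (fun i => (e i : ℂ)⁻¹) *
        ((g : Matrix (Fin N) (Fin N) ℂ) * diagonal d * ((g⁻¹ : GL (Fin N) ℂ) : Matrix (Fin N) (Fin N) ℂ))ᴴ) k k‖ := by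
  rw [conj_diagonal_mul_formInv_mul_conjTranspose he hg d, mul_diagonal_mul_conjTranspose_apply_self]
  -- every term is the real number `t_m = |d_m|² e_m⁻¹ |g_{km}|²`
  have hterm : ∀ m, d m * (e m : ℂ)⁻¹ * star (d m) * ((g : Matrix (Fin N) (Fin N) ℂ) k m * star ((g : Matrix (Fin N) (Fin N) ℂ) k m)) =
      ((Complex.normSq (d m) * (e m)⁻¹ * Complex.normSq ((g : Matrix (Fin N) (Fin N) ℂ) k m) : ℝ) : ℂ) := by
    intro m
    simp only [RCLike.star_def]
    rw [show d m * (e m : ℂ)⁻¹ * conj (d m) * ((g : Matrix (Fin N) (Fin N) ℂ) k m * conj ((g : Matrix (Fin N) (Fin N) ℂ) k m)) =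
        (e m : ℂ)⁻¹ * (d m * conj (d m)) * ((g : Matrix (Fin N) (Fin N) ℂ) k m * conj ((g : Matrix (Fin N) (Fin N) ℂ) k m)) by ring,
      Complex.mul_conj, Complex.mul_conj]
    push_cast
    ring
  simp_rw [hterm]
  rw [← Complex.ofReal_sum, Complex.norm_real, Real.norm_eq_abs, Complex.sq_norm]
  -- the signed sum: `e_i · t_m ≥ 0` for every `m`
  have hnn : ∀ m, 0 ≤ e i * (Complex.normSq (d m) * (e m)⁻¹ * Complex.normSq ((g : Matrix (Fin N) (Fin N) ℂ) k m)) := by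
    intro m
    by_cases hm : d m = 0
    · rw [hm, map_zero, zero_mul, zero_mul, mul_zero]
    · have hpos : 0 < e i * (e m)⁻¹ := by
        have h := hsign m hm
        have hem : e m ≠ 0 := he m
        have : e i * (e m)⁻¹ = e i * e m / (e m * e m) := by field_simp
        rw [this]
        exact div_pos h (mul_self_pos.mpr hem)
      have : e i * (Complex.normSq (d m) * (e m)⁻¹ * Complex.normSq ((g : Matrix (Fin N) (Fin N) ℂ) k m)) =
          (e i * (e m)⁻¹) * (Complex.normSq (d m) * Complex.normSq ((g : Matrix (Fin N) (Fin N) ℂ) k m)) := by ring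
      rw [this]
      exact mul_nonneg hpos.le (mul_nonneg (Complex.normSq_nonneg _) (Complex.normSq_nonneg _))
  have hsum : |e i| * |∑ m, Complex.normSq (d m) * (e m)⁻¹ * Complex.normSq ((g : Matrix (Fin N) (Fin N) ℂ) k m)| =
      ∑ m, e i * (Complex.normSq (d m) * (e m)⁻¹ * Complex.normSq ((g : Matrix (Fin N) (Fin N) ℂ) k m)) := by
    rw [← abs_mul, Finset.mul_sum, abs_of_nonneg (Finset.sum_nonneg fun m _ => hnn m)]
  have hi : e i * (Complex.normSq (d i) * (e i)⁻¹ * Complex.normSq ((g : Matrix (Fin N) (Fin N) ℂ) k i)) =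
      Complex.normSq (d i) * Complex.normSq ((g : Matrix (Fin N) (Fin N) ℂ) k i) := by
    rw [mul_comm (Complex.normSq (d i)) ((e i)⁻¹), mul_assoc ((e i)⁻¹), ← mul_assoc (e i), mul_inv_cancel₀ (he i), one_mul]
  have hle : Complex.normSq (d i) * Complex.normSq ((g : Matrix (Fin N) (Fin N) ℂ) k i) ≤
      |e i| * |∑ m, Complex.normSq (d m) * (e m)⁻¹ * Complex.normSq ((g : Matrix (Fin N) (Fin N) ℂ) k m)| := by
    rw [hsum, ← hi]
    exact Finset.single_le_sum (f := fun m => e i * (Complex.normSq (d m) * (e m)⁻¹ * Complex.normSq ((g : Matrix (Fin N) (Fin N) ℂ) k m)))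
      (fun m _ => hnn m) (Finset.mem_univ i)
  have hdpos : 0 < Complex.normSq (d i) := Complex.normSq_pos.mpr hdi
  rw [mul_comm (|e i|) (Complex.normSq (d i))⁻¹, mul_assoc, ← div_eq_inv_mul]
  exact (le_div_iff₀ hdpos).mpr (by rw [mul_comm]; exact hle)

end Algebra

/-! ## §2 Joint properness of `(g, z) ↦ g·diag z·g⁻¹` over a BLOCK-SEPARATED parameter set with constant-sign blocks -/

section Proper

variable (L : Type) [Field L] (N : ℕ) (α : Fin N → L) (w : {w : InfinitePlace L // IsComplex w})

/-- **JOINT PROPERNESS OF CONJUGATION OVER A BLOCK-SEPARATED COMPACT SET WITH CONSTANT-SIGN BLOCKS** — in `G_w = U(σ_w diag α)(ℂ)` of ANY signature: for a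
labelling `b` of the torus coordinates such that two DISTINCT coordinates with the same label have weights `re σ_w(α_i)` of the same sign, a compact `K` of parameters
whose coincidences `z_i = z_j` only occur inside blocks, and a compact `C ⊆ G_w`, the set of `g ∈ G_w` conjugating SOME `diag z`, `z ∈ K`, into `C` is COMPACT.
(`b` injective = ★ FILE A `isCompact_setOf_exists_conj_circleDiagonal_mem`; `b 0 = b 2 ≠ b 1` on `U(2,1)` = the compact wall.)  Proof: first projection of the closed
pair set, whose `g`- and `g⁻¹`-entries are bounded by §1 on the compact image of `C × K`, inside the closed embedding `g ↦ (g, g⁻¹)` of `G_w` into `M_N(ℂ)²`.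
[cite: Rogawski1990, §8.2 pp. 122–123] [cite: DeitmarEchterhoff2014, Lemma 9.3.3] -/
theorem isCompact_setOf_exists_conj_circleDiagonal_mem_of_blocks (hα : ∀ i, α i ≠ 0) (hreal : ∀ i, (w.1.embedding (α i)).im = 0)
    {ι : Type*} (b : Fin N → ι) (hsign : ∀ i j, i ≠ j → b i = b j → 0 < (w.1.embedding (α i)).re * (w.1.embedding (α j)).re)
    {K : Set (Fin N → Circle)} (hK : IsCompact K) (hKsep : K ⊆ {z | ∀ i j, b i ≠ b j → z i ≠ z j})
    {C : Set (archLocal L N (Matrix.diagonal α) w)} (hC : IsCompact C) :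
    IsCompact {g : archLocal L N (Matrix.diagonal α) w | ∃ z ∈ K,
      g * ⟨circleDiagonal N z, circleDiagonal_mem_archLocal_diagonal L N α w z⟩ * g⁻¹ ∈ C} := by
  classical
  -- the real weights
  obtain ⟨e, he_def⟩ : ∃ e : Fin N → ℝ, e = fun i => (w.1.embedding (α i)).re := ⟨_, rfl⟩
  have he : ∀ i, e i ≠ 0 := fun i => by rw [he_def]; exact re_embedding_ne_zero L N α w hα hreal i
  have he' : ∀ i, (e i : ℂ) ≠ 0 := fun i => Complex.ofReal_ne_zero.mpr (he i)
  have hmem : ∀ g : archLocal L N (Matrix.diagonal α) w, (g : GL (Fin N) ℂ) ∈ unitaryGroupOfForm (starRingEnd ℂ) (diagonal fun i => (e i : ℂ)) := by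
    intro g; rw [he_def]; exact (mem_archLocal_diagonal_iff_mem_unitaryGroupOfForm L N α w hreal _).mp g.2
  have hsign' : ∀ i m, b m = b i → 0 < e i * e m := by
    intro i m hbm
    by_cases him : i = m
    · subst him; exact mul_self_pos.mpr (he i)
    · rw [he_def]; exact hsign i m him hbm.symm
  -- the pair set `M = {(g, z) | z ∈ K, g·diag z·g⁻¹ ∈ C}`
  obtain ⟨M, hM⟩ : ∃ M : Set (archLocal L N (Matrix.diagonal α) w × (Fin N → Circle)),
      M = {p | p.2 ∈ K ∧ p.1 * ⟨circleDiagonal N p.2, circleDiagonal_mem_archLocal_diagonal L N α w p.2⟩ * p.1⁻¹ ∈ C} := ⟨_, rfl⟩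
  have ht : Continuous fun p : archLocal L N (Matrix.diagonal α) w × (Fin N → Circle) =>
      (⟨circleDiagonal N p.2, circleDiagonal_mem_archLocal_diagonal L N α w p.2⟩ : archLocal L N (Matrix.diagonal α) w) :=
    ((continuous_circleDiagonal N).comp continuous_snd).subtype_mk _
  have hconj : Continuous fun p : archLocal L N (Matrix.diagonal α) w × (Fin N → Circle) =>
      p.1 * ⟨circleDiagonal N p.2, circleDiagonal_mem_archLocal_diagonal L N α w p.2⟩ * p.1⁻¹ :=
    (continuous_fst.mul ht).mul continuous_fst.inv
  have hMclosed : IsClosed M := by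
    rw [hM]; exact (hK.isClosed.preimage continuous_snd).inter (hC.isClosed.preimage hconj)
  -- the block data: for each `i`, the list of indices OUTSIDE the block of `i`, the products `λ^{(i)}` and the matrices `Q_i`
  obtain ⟨lst, hlst⟩ : ∃ lst : Fin N → List (Fin N), lst = fun i => (Finset.univ.filter fun j => b j ≠ b i).toList := ⟨_, rfl⟩
  have hmem_lst : ∀ i j, j ∈ lst i ↔ b j ≠ b i := fun i j => by rw [hlst]; simp
  obtain ⟨lam, hlam⟩ : ∃ lam : Fin N → (Fin N → ℂ) → Fin N → ℂ, lam = fun i z m => ((lst i).map fun j => z m - z j).prod := ⟨_, rfl⟩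
  obtain ⟨Q, hQ⟩ : ∃ Q : Fin N → Matrix (Fin N) (Fin N) ℂ × (Fin N → ℂ) → Matrix (Fin N) (Fin N) ℂ,
      Q = fun i p => ((lst i).map fun j => p.1 - p.2 j • (1 : Matrix (Fin N) (Fin N) ℂ)).prod := ⟨_, rfl⟩
  -- `λ^{(i)}_m ≠ 0 ⇒ m` is in the block of `i`; `λ^{(i)}_i ≠ 0` on the block-separated set
  have hlam_block : ∀ i (z : Fin N → ℂ) m, lam i z m ≠ 0 → b m = b i := by
    intro i z m h
    by_contra hbm
    apply h
    rw [hlam]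
    exact List.prod_eq_zero (List.mem_map.mpr ⟨m, (hmem_lst i m).mpr hbm, sub_self _⟩)
  have hlam_ne : ∀ i (z : Fin N → ℂ), (∀ i' j', b i' ≠ b j' → z i' ≠ z j') → lam i z i ≠ 0 := by
    intro i z hz
    rw [hlam]
    refine List.prod_ne_zero fun h0 => ?_
    obtain ⟨j, hj, hji⟩ := List.mem_map.mp h0
    exact hz i j (fun hb => ((hmem_lst i j).mp hj) hb.symm) (sub_eq_zero.mp hji)
  -- continuity of `Q_i` and of `λ^{(i)}`
  have hQc : ∀ i, Continuous (Q i) := fun i => by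
    rw [hQ]
    exact continuous_list_prod _ fun j _ => continuous_fst.sub (((continuous_apply j).comp continuous_snd).smul continuous_const)
  have hlamc : ∀ i m, Continuous fun z : Fin N → ℂ => lam i z m := fun i m => by
    rw [hlam]
    exact continuous_list_prod _ fun j _ => (continuous_apply m).sub (continuous_apply j)
  -- the entry bound `θ` on the compact image `π(C × K) ⊆ M_N(ℂ) × {z block-separated}`
  obtain ⟨θ, hθ⟩ : ∃ θ : Matrix (Fin N) (Fin N) ℂ × (Fin N → ℂ) → ℝ, θ = fun p =>
      ∑ k, ∑ i, |e i| * (Complex.normSq (lam i p.2 i))⁻¹ *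
        ‖(Q i p * diagonal (fun i => (e i : ℂ)⁻¹) * (Q i p)ᴴ) k k‖ := ⟨_, rfl⟩
  have hθc : ContinuousOn θ {p | ∀ i j, b i ≠ b j → p.2 i ≠ p.2 j} := by
    rw [hθ]
    refine continuousOn_finsetSum _ fun k _ => continuousOn_finsetSum _ fun i _ => ?_
    refine (continuousOn_const.mul ?_).mul ?_
    · refine ((Complex.continuous_normSq.comp ((hlamc i i).comp continuous_snd)).continuousOn).inv₀ fun p hp => ?_
      exact (Complex.normSq_pos.mpr (hlam_ne i p.2 hp)).ne'
    · exact ((((hQc i).matrix_mul continuous_const).matrix_mul (hQc i).matrix_conjTranspose).matrix_elem k k).norm.continuousOn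
  have hπ : Continuous fun q : archLocal L N (Matrix.diagonal α) w × (Fin N → Circle) =>
      ((((q.1 : GL (Fin N) ℂ) : Matrix (Fin N) (Fin N) ℂ)), fun j => (q.2 j : ℂ)) :=
    (Units.continuous_val.comp (continuous_subtype_val.comp continuous_fst)).prodMk
      (continuous_pi fun j => continuous_subtype_val.comp ((continuous_apply j).comp continuous_snd))
  have hCK : IsCompact ((fun q : archLocal L N (Matrix.diagonal α) w × (Fin N → Circle) =>
      ((((q.1 : GL (Fin N) ℂ) : Matrix (Fin N) (Fin N) ℂ)), fun j => (q.2 j : ℂ))) '' (C ×ˢ K)) := (hC.prod hK).image hπ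
  have hCKsub : (fun q : archLocal L N (Matrix.diagonal α) w × (Fin N → Circle) =>
      ((((q.1 : GL (Fin N) ℂ) : Matrix (Fin N) (Fin N) ℂ)), fun j => (q.2 j : ℂ))) '' (C ×ˢ K) ⊆
      {p : Matrix (Fin N) (Fin N) ℂ × (Fin N → ℂ) | ∀ i j, b i ≠ b j → p.2 i ≠ p.2 j} := by
    rintro _ ⟨q, hq, rfl⟩ i j hb h
    exact hKsep hq.2 i j hb (Subtype.val_injective h)
  obtain ⟨R, hR⟩ := hCK.exists_bound_of_continuousOn (hθc.mono hCKsub)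
  -- the box of matrices with entries bounded by `R'`
  obtain ⟨R', hR'⟩ : ∃ R' : ℝ, R' = max (Real.sqrt R) ((∑ j, ‖(e j : ℂ)‖⁻¹) * Real.sqrt R * ∑ j, ‖(e j : ℂ)‖) := ⟨_, rfl⟩
  have hBox : IsCompact {A : Matrix (Fin N) (Fin N) ℂ | ∀ k i, ‖A k i‖ ≤ R'} := by
    have hb : IsCompact ((Set.univ.pi fun (_ : Fin N) => Set.univ.pi fun (_ : Fin N) => Metric.closedBall (0 : ℂ) R') :
        Set (Matrix (Fin N) (Fin N) ℂ)) :=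
      isCompact_univ_pi fun _ => isCompact_univ_pi fun _ => isCompact_closedBall (0 : ℂ) R'
    have hEq : {A : Matrix (Fin N) (Fin N) ℂ | ∀ k i, ‖A k i‖ ≤ R'} =
        ((Set.univ.pi fun (_ : Fin N) => Set.univ.pi fun (_ : Fin N) => Metric.closedBall (0 : ℂ) R') : Set (Matrix (Fin N) (Fin N) ℂ)) := by
      ext A
      refine ⟨fun h k _ i _ => ?_, fun h k i => ?_⟩
      · simpa only [Metric.mem_closedBall, dist_zero_right] using h k i
      · simpa only [Metric.mem_closedBall, dist_zero_right] using h k (Set.mem_univ k) i (Set.mem_univ i)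
    rw [hEq]
    exact hb
  -- the closed embedding `g ↦ (g, g⁻¹)` of `G_w` into `M_N(ℂ) × M_N(ℂ)`
  have hψ : IsClosedEmbedding fun g : archLocal L N (Matrix.diagonal α) w =>
      ((((g : GL (Fin N) ℂ) : Matrix (Fin N) (Fin N) ℂ)), ((((g : GL (Fin N) ℂ))⁻¹ : GL (Fin N) ℂ) : Matrix (Fin N) (Fin N) ℂ)) := by
    have h1 : IsClosedEmbedding fun g : archLocal L N (Matrix.diagonal α) w => (g : GL (Fin N) ℂ) :=
      (isClosed_archLocal L N (Matrix.diagonal α) w).isClosedEmbedding_subtypeVal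
    have h2 : IsClosedEmbedding (Units.embedProduct (Matrix (Fin N) (Fin N) ℂ)) := Units.isClosedEmbedding_embedProduct
    have h3 := ((Homeomorph.refl (Matrix (Fin N) (Fin N) ℂ)).prodCongr
      (@MulOpposite.opHomeomorph (Matrix (Fin N) (Fin N) ℂ) _).symm).isClosedEmbedding
    exact (h3.comp h2).comp h1
  have hB : IsCompact ((fun g : archLocal L N (Matrix.diagonal α) w =>
      ((((g : GL (Fin N) ℂ) : Matrix (Fin N) (Fin N) ℂ)), ((((g : GL (Fin N) ℂ))⁻¹ : GL (Fin N) ℂ) : Matrix (Fin N) (Fin N) ℂ))) ⁻¹'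
      ({A : Matrix (Fin N) (Fin N) ℂ | ∀ k i, ‖A k i‖ ≤ R'} ×ˢ {A : Matrix (Fin N) (Fin N) ℂ | ∀ k i, ‖A k i‖ ≤ R'})) :=
    hψ.isCompact_preimage (hBox.prod hBox)
  -- `M ⊆ B × K`: the entries of `g` and `g⁻¹` are bounded on `M`
  have hMsub : M ⊆ ((fun g : archLocal L N (Matrix.diagonal α) w =>
      ((((g : GL (Fin N) ℂ) : Matrix (Fin N) (Fin N) ℂ)), ((((g : GL (Fin N) ℂ))⁻¹ : GL (Fin N) ℂ) : Matrix (Fin N) (Fin N) ℂ))) ⁻¹'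
      ({A : Matrix (Fin N) (Fin N) ℂ | ∀ k i, ‖A k i‖ ≤ R'} ×ˢ {A : Matrix (Fin N) (Fin N) ℂ | ∀ k i, ‖A k i‖ ≤ R'})) ×ˢ K := by
    rw [hM]
    rintro ⟨g, z⟩ ⟨hzK, hgC⟩
    have hzsep : ∀ i j, b i ≠ b j → (z i : ℂ) ≠ z j := fun i j hb h => hKsep hzK i j hb (Subtype.val_injective h)
    have hg := hmem g
    -- the conjugate, as a matrix
    have hx : ((((g * ⟨circleDiagonal N z, circleDiagonal_mem_archLocal_diagonal L N α w z⟩ * g⁻¹ :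
        archLocal L N (Matrix.diagonal α) w) : GL (Fin N) ℂ) : Matrix (Fin N) (Fin N) ℂ)) =
        ((g : GL (Fin N) ℂ) : Matrix (Fin N) (Fin N) ℂ) * Matrix.diagonal (fun j => (z j : ℂ)) *
          ((((g : GL (Fin N) ℂ))⁻¹ : GL (Fin N) ℂ) : Matrix (Fin N) (Fin N) ℂ) := by
      rw [Subgroup.coe_mul, Subgroup.coe_mul, Subgroup.coe_inv, Units.val_mul, Units.val_mul]
      rfl
    have hmemCK := Set.mem_image_of_mem (fun q : archLocal L N (Matrix.diagonal α) w × (Fin N → Circle) =>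
        ((((q.1 : GL (Fin N) ℂ) : Matrix (Fin N) (Fin N) ℂ)), fun j => (q.2 j : ℂ)))
      (Set.mk_mem_prod hgC hzK)
    have h := hR _ hmemCK
    rw [hθ] at h
    dsimp only at h
    rw [Real.norm_of_nonneg (Finset.sum_nonneg fun _ _ => Finset.sum_nonneg fun _ _ =>
      mul_nonneg (mul_nonneg (abs_nonneg _) (inv_nonneg.mpr (Complex.normSq_nonneg _))) (norm_nonneg _))] at h
    -- `Q_i` at the conjugate IS `g·diag λ^{(i)}·g⁻¹`
    have hQg : ∀ i, Q i (((((g * ⟨circleDiagonal N z, circleDiagonal_mem_archLocal_diagonal L N α w z⟩ * g⁻¹ :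
        archLocal L N (Matrix.diagonal α) w) : GL (Fin N) ℂ) : Matrix (Fin N) (Fin N) ℂ)), fun j => (z j : ℂ)) =
        ((g : GL (Fin N) ℂ) : Matrix (Fin N) (Fin N) ℂ) * diagonal (lam i (fun j => (z j : ℂ))) *
          ((((g : GL (Fin N) ℂ))⁻¹ : GL (Fin N) ℂ) : Matrix (Fin N) (Fin N) ℂ) := by
      intro i
      rw [hQ, hlam]
      dsimp only
      rw [hx, list_prod_map_conj_diagonal_sub_smul_one]
    have hsq : ∀ k i, ‖((g : GL (Fin N) ℂ) : Matrix (Fin N) (Fin N) ℂ) k i‖ ^ 2 ≤ R := by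
      intro k i
      have hbd := norm_apply_sq_le_of_block he hg (lam i fun j => (z j : ℂ)) i k (hlam_ne i _ hzsep)
        (fun m hm => hsign' i m (hlam_block i _ m hm))
      rw [← hQg i] at hbd
      refine hbd.trans (le_trans ?_ h)
      refine le_trans ?_ (Finset.single_le_sum (f := fun k' => ∑ i', |e i'| * (Complex.normSq (lam i' (fun j => (z j : ℂ)) i'))⁻¹ *
          ‖(Q i' (((((g * ⟨circleDiagonal N z, circleDiagonal_mem_archLocal_diagonal L N α w z⟩ * g⁻¹ :
            archLocal L N (Matrix.diagonal α) w) : GL (Fin N) ℂ) : Matrix (Fin N) (Fin N) ℂ)), fun j => (z j : ℂ)) *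
            diagonal (fun i => (e i : ℂ)⁻¹) *
            (Q i' (((((g * ⟨circleDiagonal N z, circleDiagonal_mem_archLocal_diagonal L N α w z⟩ * g⁻¹ :
              archLocal L N (Matrix.diagonal α) w) : GL (Fin N) ℂ) : Matrix (Fin N) (Fin N) ℂ)), fun j => (z j : ℂ)))ᴴ) k' k'‖)
        (fun k' _ => Finset.sum_nonneg fun _ _ =>
          mul_nonneg (mul_nonneg (abs_nonneg _) (inv_nonneg.mpr (Complex.normSq_nonneg _))) (norm_nonneg _)) (Finset.mem_univ k))
      exact Finset.single_le_sum (f := fun i' => |e i'| * (Complex.normSq (lam i' (fun j => (z j : ℂ)) i'))⁻¹ *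
          ‖(Q i' (((((g * ⟨circleDiagonal N z, circleDiagonal_mem_archLocal_diagonal L N α w z⟩ * g⁻¹ :
            archLocal L N (Matrix.diagonal α) w) : GL (Fin N) ℂ) : Matrix (Fin N) (Fin N) ℂ)), fun j => (z j : ℂ)) *
            diagonal (fun i => (e i : ℂ)⁻¹) *
            (Q i' (((((g * ⟨circleDiagonal N z, circleDiagonal_mem_archLocal_diagonal L N α w z⟩ * g⁻¹ :
              archLocal L N (Matrix.diagonal α) w) : GL (Fin N) ℂ) : Matrix (Fin N) (Fin N) ℂ)), fun j => (z j : ℂ)))ᴴ) k k‖)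
        (fun i' _ => mul_nonneg (mul_nonneg (abs_nonneg _) (inv_nonneg.mpr (Complex.normSq_nonneg _))) (norm_nonneg _)) (Finset.mem_univ i)
    have hnorm : ∀ k i, ‖((g : GL (Fin N) ℂ) : Matrix (Fin N) (Fin N) ℂ) k i‖ ≤ Real.sqrt R := fun k i =>
      (le_abs_self _).trans (Real.abs_le_sqrt (hsq k i))
    refine ⟨⟨fun k i => (hnorm k i).trans (by rw [hR']; exact le_max_left _ _), fun i k => ?_⟩, hzK⟩
    rw [norm_coe_inv_apply_of_mem_unitaryGroupOfForm_diagonal he' hg, hR']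
    refine le_trans ?_ (le_max_right _ _)
    have hci' : ‖(e i : ℂ)‖⁻¹ ≤ ∑ j, ‖(e j : ℂ)‖⁻¹ :=
      Finset.single_le_sum (f := fun j => ‖(e j : ℂ)‖⁻¹) (fun j _ => inv_nonneg.mpr (norm_nonneg _)) (Finset.mem_univ i)
    have hce' : ‖(e k : ℂ)‖ ≤ ∑ j, ‖(e j : ℂ)‖ :=
      Finset.single_le_sum (f := fun j => ‖(e j : ℂ)‖) (fun j _ => norm_nonneg _) (Finset.mem_univ k)
    gcongr
    exact hnorm k i
  have hMc : IsCompact M := (hB.prod hK).of_isClosed_subset hMclosed hMsub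
  have hS : {g : archLocal L N (Matrix.diagonal α) w | ∃ z ∈ K,
      g * ⟨circleDiagonal N z, circleDiagonal_mem_archLocal_diagonal L N α w z⟩ * g⁻¹ ∈ C} = Prod.fst '' M := by
    rw [hM]
    ext g
    simp only [Set.mem_setOf_eq, Set.mem_image, Prod.exists, exists_and_right, exists_eq_right]
  rw [hS]
  exact hMc.image continuous_fst

/-- Compact support of `g ↦ f(g·diag z·g⁻¹)` at a point of the block-separated set (e.g. ON a compact wall). [cite: Rogawski1990, §8.2 p. 122]
[cite: DeitmarEchterhoff2014, Lemma 9.3.3] -/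
theorem hasCompactSupport_comp_conj_circleDiagonal_of_blocks (hα : ∀ i, α i ≠ 0) (hreal : ∀ i, (w.1.embedding (α i)).im = 0)
    {ι : Type*} (b : Fin N → ι) (hsign : ∀ i j, i ≠ j → b i = b j → 0 < (w.1.embedding (α i)).re * (w.1.embedding (α j)).re)
    {z : Fin N → Circle} (hz : ∀ i j, b i ≠ b j → z i ≠ z j)
    {E : Type*} [Zero E] (f : archLocal L N (Matrix.diagonal α) w → E) (hfc : HasCompactSupport f) :
    HasCompactSupport fun g : archLocal L N (Matrix.diagonal α) w =>
      f (g * ⟨circleDiagonal N z, circleDiagonal_mem_archLocal_diagonal L N α w z⟩ * g⁻¹) := by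
  refine HasCompactSupport.intro (isCompact_setOf_exists_conj_circleDiagonal_mem_of_blocks L N α w hα hreal b hsign isCompact_singleton
    (Set.singleton_subset_iff.mpr hz) hfc.isCompact) fun g hg => ?_
  exact image_eq_zero_of_notMem_tsupport fun h => hg ⟨z, rfl, h⟩

end Proper

end Literature.NumberTheory.Automorphic.UnitaryGroup

end
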